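import Mathlib
import HarnessLib
import Literature.Analysis.FluidPDE.SuitableWeak
import Literature.Analysis.FluidPDE.SelfSimilar
import Literature.Analysis.FluidPDE.LocalTypeI
import Literature.Analysis.FluidPDE.SpaceTimeRescaling
import Literature.Analysis.FluidPDE.LocalTypeIScaling
import Literature.Analysis.FluidPDE.LocalTypeICongr
import Literature.Analysis.FluidPDE.LocalTypeIReverseZoom
import Literature.Analysis.FluidPDE.SlabTypeICompactness
import Literature.Analysis.FluidPDE.TypeIRateOseenMildRepresentative
import Summits.NavierStokesRegularity.NavierStokesRegularity.Theorems.RellichScarApexLocalisationSpherePersistence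
import Summits.NavierStokesRegularity.NavierStokesRegularity.Theorems.RellichScarApexLocalisationFinalSliceNull
import Summits.NavierStokesRegularity.NavierStokesRegularity.Theorems.RellichScarApexLocalisationMovingCentrePersistence
import Summits.NavierStokesRegularity.NavierStokesRegularity.Theorems.RellichScarApexLocalisationOnionShells
import Summits.NavierStokesRegularity.NavierStokesRegularity.Theorems.RellichScarApexLocalisationBetOptimality
import Summits.NavierStokesRegularity.NavierStokesRegularity.Theses.RellichScar

/-!
# Skeleton v3.1 — line `decaying-ancient-bridge` (continuation, lead c1) for crux `RellichScar.ApexLocalisation`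
(stmt-NavierStokesRegularity-11719; lead prover-line-stmt-NavierStokesRegularity-11719-c1-0)

RESHAPE of the line after lead 0 (whose five known stubs, the ∀-hull bet ⇒ crux reduction and the
mild ∃-form equivalence are all LANDED): the ∀-hull bet `stub_hullSelection` is retired from the
composition and replaced by the route file's own foreseen PROFILE-SIDE split
"ApexLocalisation ⇐ OrbitClosureDichotomy → FinalSliceSparsity" (Theses/RellichScar.lean, TWO-LAYER
PLAN), in a form WITHOUT moving centres:

* `stub_spherePersistence` (KNOWN; A–B engine `slab_typeI_compactness` + zoom/translation
  covariance + continuity ⇒ `L^∞`-blow-up): Navier–Stokes images `λ_k u(λ_k² t, x_k + λ_k x)` of a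
  continuous rate-Type-I slab profile with `𝐈 ≤ I` whose values AT THE NEW ORIGIN blow up at times
  `t_k ↑ 0` subconverge in `L³(Q(0,R))` (∀R) to a continuous rate profile with `𝐈 ≤ 4I` that is
  SINGULAR AT THE ORIGIN.
* `stub_finalSliceNull` (KNOWN; CKN Theorem B run with BACKWARD cylinders at the top of the slab —
  tree `seregin2014_thm14_holds` + the Vitali machinery of `CKNTheoremB.lean`): the final-time
  singular set of a slab profile with `𝐈 < ⊤` has `ℋ¹ = 0`, hence Lebesgue-null radial image.
* `stub_movingCentrePersistence` (KNOWN; engine + continuity of translation in `L³` +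
  uniqueness of `L³_loc` limits): if class profiles `u_k → v` in `L³(Q(0,R))` ∀R and
  `‖u_k(t_k, x_k)‖ → ∞` with `t_k ↑ 0`, `x_k → x₀`, then `v` is singular at `(0, x₀)`.
* `stub_onionShells` (KNOWN modulo the two previous stubs, which it takes as explicit inputs;
  card baire-onion-normal-form (O1)/(O2) without Baire: compactness + CKN): uniformly over the class
  `(C, I)`, every scale range `[R, 2R]` contains a shell of relative thickness `κ(C,I) > 0` on which
  `‖u(t,x)‖ ≤ 1/(κ‖x‖·)` for ALL `t < 0` — the final-time singular set is uniformly radially porous.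
* `stub_sparseSelection` (THE BET = FinalSliceSparsity in ∃-form; crux-equivalent given
  `orbitDichotomy`): granted the onion, if a rate-Type-I singular profile exists then some continuous
  singular class profile has NO shell-centred image sequence (`λ_k ≤ ‖x_k‖ ≤ 2λ_k`) converging to an
  origin-singular profile.

Glue proved here: `shellUniformityGivesApex'` (Disproof §9, re-proved: shell uniformity of all zooms
⇒ the apex bound), `orbitDichotomy` (apex, or a shell-centred image sequence with an origin-singular
limit), `ApexLocalisation_of` (the crux BY NAME). STATUS v3.1: stubs 1–4 LANDED (imported; p98392,
p98775, p98613, p98685) together with the crux ⇒ bet certificate (p98706); the ONLY `sorry` left is the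
bet `stub_sparseSelection`, which is therefore EXACTLY as strong as the crux.

Everything is INLINED (no new definitions). Class data of a profile `(u,p,G)` with constants `(C, I)`:
`IsSuitableWeakSolutionOn 𝕊 1 0 u p`, `HasWeakSpatialGradientOn 𝕊 u G`, `typeIBound (Iio 0 ×ˢ univ) u p G ≤ I`,
`HasTypeITimeDecay C u` (+ `ContinuousOn (uncurry u) (Iio 0 ×ˢ univ)` where pointwise values are used),
`𝕊 = slab E³ (Iio 0) isOpen_Iio`. Images: `c • stPull (c^2) c 0 x₀ u = fun t x => c • u (c² t, x₀ + c x)`.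
-/

-- the summit and its single sub-problem share the name (CONVENTIONS §1), as in every Theorems file
set_option linter.dupNamespace false

namespace Summit.NavierStokesRegularity.NavierStokesRegularity.Theorems.RellichScarApexLocalisation

open MeasureTheory Set Function Metric Filter Topology TopologicalSpace
open scoped ENNReal NNReal
open Literature.Analysis Literature.Analysis.FluidPDE

local notation "E³" => EuclideanSpace ℝ (Fin 3)

/-! ### Stubs 1–4 — LANDED (imported above)

* `stub_spherePersistence`  — `…Theorems.RellichScarApexLocalisationSpherePersistence` (p98392)
* `stub_finalSliceNull`     — `…Theorems.RellichScarApexLocalisationFinalSliceNull` (p98775)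
* `stub_movingCentrePersistence` — `…Theorems.RellichScarApexLocalisationMovingCentrePersistence` (p98613)
* `stub_onionShells`        — `…Theorems.RellichScarApexLocalisationOnionShells` (p98685)
* certificate crux ⇒ bet: `sparseSelection_of_apexLocalisation` — `…Theorems.RellichScarApexLocalisationBetOptimality` (p98706)
-/

/-! ### Stub 5 — THE BET: sparse selection (FinalSliceSparsity, ∃-form) -/

/-- **THE BET — sparse selection** (`FinalSliceSparsity` of the route's two-layer plan, ∃-form;
crux-equivalent given `orbitDichotomy`). Granted the onion shells: if a rate-Type-I singular slab
profile exists (the crux antecedent, some `C`), then for some `C'`, `I' < ⊤` there is a CONTINUOUS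
rate-Type-I suitable weak slab profile `(u,p,G)` with `𝐈 ≤ I'`, singular at the origin, such that NO
sequence of its shell-centred Navier–Stokes images `λ_k u(λ_k² t, x_k + λ_k x)`, `λ_k ≤ ‖x_k‖ ≤ 2λ_k`,
converges in `L³(Q(0,R))` (∀R) to a continuous rate-`C'` class profile with `𝐈 ≤ 4I'` that is
singular at the origin — "some profile in the class has a scale-invariantly isolated final-time
singular point". The open content of the crux (symmetry-free KNSS (1.4) ⇒ (1.6) at the level of
existence); its enemy is a scaling-recurrent Cantor dust of final-time singular points, which the
onion confines between clear shells at every scale but does not exclude. -/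
theorem stub_sparseSelection :
    (∀ (C : ℝ) (I : ℝ≥0∞), I < ⊤ → ∃ κ : ℝ, 0 < κ ∧
      ∀ (u : ℝ → E³ → E³) (p : ℝ → E³ → ℝ) (G : ℝ → E³ → E³ →L[ℝ] E³),
        IsSuitableWeakSolutionOn (slab E³ (Iio 0) isOpen_Iio) 1 0 u p →
        HasWeakSpatialGradientOn (slab E³ (Iio 0) isOpen_Iio) u G →
        typeIBound (Iio (0 : ℝ) ×ˢ univ) u p G ≤ I →
        HasTypeITimeDecay C u →
        ContinuousOn (uncurry u) (Iio (0 : ℝ) ×ˢ univ) →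
        ∀ R : ℝ, 0 < R → ∃ a : ℝ, R ≤ a ∧ a * (1 + κ) ≤ 2 * R ∧
          ∀ t : ℝ, t < 0 → ∀ x : E³, a ≤ ‖x‖ → ‖x‖ ≤ a * (1 + κ) → ‖u t x‖ ≤ (κ * a)⁻¹) →
    ∀ C : ℝ,
      (∃ (u : ℝ → E³ → E³) (p : ℝ → E³ → ℝ) (G : ℝ → E³ → E³ →L[ℝ] E³),
        IsSuitableWeakSolutionOn (slab E³ (Iio 0) isOpen_Iio) 1 0 u p ∧
        HasWeakSpatialGradientOn (slab E³ (Iio 0) isOpen_Iio) u G ∧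
        typeIBound (Iio (0 : ℝ) ×ˢ univ) u p G < ⊤ ∧
        HasTypeITimeDecay C u ∧ IsBackwardSingularPoint u 0) →
      ∃ (C' : ℝ) (I' : ℝ≥0∞) (u : ℝ → E³ → E³) (p : ℝ → E³ → ℝ) (G : ℝ → E³ → E³ →L[ℝ] E³),
        I' < ⊤ ∧
        IsSuitableWeakSolutionOn (slab E³ (Iio 0) isOpen_Iio) 1 0 u p ∧
        HasWeakSpatialGradientOn (slab E³ (Iio 0) isOpen_Iio) u G ∧
        typeIBound (Iio (0 : ℝ) ×ˢ univ) u p G ≤ I' ∧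
        HasTypeITimeDecay C' u ∧
        ContinuousOn (uncurry u) (Iio (0 : ℝ) ×ˢ univ) ∧
        IsBackwardSingularPoint u 0 ∧
        ∀ (lk : ℕ → ℝ) (xk : ℕ → E³) (v : ℝ → E³ → E³) (q : ℝ → E³ → ℝ)
          (H : ℝ → E³ → E³ →L[ℝ] E³),
          (∀ k, 0 < lk k ∧ lk k ≤ ‖xk k‖ ∧ ‖xk k‖ ≤ 2 * lk k) →
          IsSuitableWeakSolutionOn (slab E³ (Iio 0) isOpen_Iio) 1 0 v q →
          HasWeakSpatialGradientOn (slab E³ (Iio 0) isOpen_Iio) v H →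
          typeIBound (Iio (0 : ℝ) ×ˢ univ) v q H ≤ 4 * I' →
          HasTypeITimeDecay C' v →
          ContinuousOn (uncurry v) (Iio (0 : ℝ) ×ˢ univ) →
          (∀ R : ℝ, 0 < R → Tendsto (fun k => eLpNorm
            (uncurry (lk k • stPull (lk k ^ 2) (lk k) 0 (xk k) u) - uncurry v) 3
            (volume.restrict (parabolicCylinder R (0 : ℝ × E³)))) atTop (𝓝 0)) →
          ¬ IsBackwardSingularPoint v 0 := by
  sorry

/-! ### Glue A — shell uniformity of all zooms gives the apex bound (Disproof §9, re-proved) -/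

/-- **Shell uniformity ⇒ apex** (the ideators' `ShellUniformityGivesApex`, proved in
`Cruxes/ApexLocalisation/Disproof.lean` §9; re-proved here because Theorems files may not import
Cruxes files): if `u` has the rate `C` and all zooms `λ u(λ² t, λ y)` are bounded by `θ⁻¹` on the
shell `1 ≤ ‖y‖ ≤ 2` during `(-θ², 0)`, then `u` has the space–time Type-I bound with
`C' = (max C 0 + 1)(θ⁻¹ + 1)`. Inside the paraboloid `‖x‖ ≤ θ⁻¹ √(−t)` the rate suffices; outside,
the zoom `λ = ‖x‖` at `y = x/‖x‖`, `s = t/‖x‖²` lands on the shell at an admissible time. -/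
theorem shellUniformityGivesApex' {u : ℝ → E³ → E³} {C θ : ℝ} (hθ : 0 < θ)
    (hrate : HasTypeITimeDecay C u)
    (hshell : ∀ lam : ℝ, 0 < lam → ∀ t : ℝ, -θ ^ 2 < t → t < 0 → ∀ y : E³, 1 ≤ ‖y‖ → ‖y‖ ≤ 2 →
      lam * ‖u (lam ^ 2 * t) (lam • y)‖ ≤ θ⁻¹) :
    HasTypeIDecay ((max C 0 + 1) * (θ⁻¹ + 1)) u := by
  set K : ℝ := θ⁻¹ with hK
  have hK0 : 0 < K := inv_pos.2 hθ
  have hθK : θ * K = 1 := by rw [hK]; field_simp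
  set C₀ : ℝ := max C 0 with hC₀
  have hC₀0 : 0 ≤ C₀ := le_max_right _ _
  have hCC₀ : C ≤ C₀ := le_max_left _ _
  intro t ht x
  have hst : 0 < Real.sqrt (-t) := Real.sqrt_pos.2 (by linarith)
  have hden : 0 < ‖x‖ + Real.sqrt (-t) := by positivity
  rw [le_div_iff₀ hden]
  by_cases hx : ‖x‖ ≤ K * Real.sqrt (-t)
  · -- inside the paraboloid: the rate suffices
    have h1 : ‖u t x‖ ≤ C₀ / Real.sqrt (-t) :=
      (hrate t ht x).trans (div_le_div_of_nonneg_right hCC₀ hst.le)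
    rw [le_div_iff₀ hst] at h1
    calc ‖u t x‖ * (‖x‖ + Real.sqrt (-t)) ≤ ‖u t x‖ * ((K + 1) * Real.sqrt (-t)) := by
          apply mul_le_mul_of_nonneg_left _ (norm_nonneg _)
          linarith
      _ = (‖u t x‖ * Real.sqrt (-t)) * (K + 1) := by ring
      _ ≤ C₀ * (K + 1) := mul_le_mul_of_nonneg_right h1 (by linarith)
      _ ≤ (C₀ + 1) * (K + 1) := by nlinarith
  · -- outside: zoom λ = ‖x‖ onto the unit shell
    push Not at hx
    have hxpos : 0 < ‖x‖ := lt_of_le_of_lt (by positivity) hx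
    set s : ℝ := t / ‖x‖ ^ 2 with hs
    set y : E³ := ‖x‖⁻¹ • x with hy
    have hy1 : ‖y‖ = 1 := by
      rw [hy, norm_smul, norm_inv, norm_norm, inv_mul_cancel₀ hxpos.ne']
    have hs0 : s < 0 := div_neg_of_neg_of_pos ht (by positivity)
    have h2 : Real.sqrt (-t) < θ * ‖x‖ := by
      have := mul_lt_mul_of_pos_left hx hθ
      rwa [← mul_assoc, hθK, one_mul] at this
    have h3 : -t < (θ * ‖x‖) ^ 2 := by
      nlinarith [h2, hst.le, Real.sq_sqrt (show (0 : ℝ) ≤ -t by linarith)]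
    have hsθ : -θ ^ 2 < s := by
      rw [hs, lt_div_iff₀ (by positivity)]
      nlinarith [h3]
    have key := hshell ‖x‖ hxpos s hsθ hs0 y (by rw [hy1]) (by rw [hy1]; norm_num)
    have e1 : ‖x‖ ^ 2 * s = t := by
      rw [hs]; field_simp
    have e2 : ‖x‖ • y = x := by
      rw [hy, smul_smul, mul_inv_cancel₀ hxpos.ne', one_smul]
    rw [e1, e2] at key
    -- key : ‖x‖ * ‖u t x‖ ≤ θ⁻¹ = K
    have hsqrt_le : Real.sqrt (-t) * K ≤ ‖x‖ := by nlinarith [hx]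
    calc ‖u t x‖ * (‖x‖ + Real.sqrt (-t))
        = ‖u t x‖ * ‖x‖ + ‖u t x‖ * Real.sqrt (-t) := by ring
      _ ≤ K + ‖u t x‖ * Real.sqrt (-t) := by nlinarith [key, norm_nonneg (u t x)]
      _ ≤ K + 1 := by
          have hu0 : 0 ≤ ‖u t x‖ := norm_nonneg _
          have h4 : ‖u t x‖ * Real.sqrt (-t) * K ≤ K := by
            calc ‖u t x‖ * Real.sqrt (-t) * K = ‖u t x‖ * (Real.sqrt (-t) * K) := by ring
              _ ≤ ‖u t x‖ * ‖x‖ := mul_le_mul_of_nonneg_left hsqrt_le hu0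
              _ = ‖x‖ * ‖u t x‖ := mul_comm _ _
              _ ≤ K := by simpa [hK] using key
          have h5 : ‖u t x‖ * Real.sqrt (-t) ≤ 1 := by
            by_contra hcon
            push Not at hcon
            have : K < ‖u t x‖ * Real.sqrt (-t) * K := by nlinarith
            linarith
          linarith
      _ ≤ (C₀ + 1) * (K + 1) := by nlinarith

/-! ### Glue B — the orbit-closure dichotomy (route: OrbitClosureDichotomy) -/

/-- **Orbit-closure dichotomy** (the route file's foreseen `OrbitClosureDichotomy`, in a form
without moving centres): a continuous rate-Type-I suitable weak slab profile with `𝐈 ≤ I < ⊤` is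
EITHER apex (`HasTypeIDecay C' u` for some `C'`), OR some sequence of its shell-centred
Navier–Stokes images `λ_k u(λ_k² t, x_k + λ_k x)` (`λ_k ≤ ‖x_k‖ ≤ 2λ_k`) converges in `L³(Q(0,R))`
(∀R) to a continuous rate-`C` class profile with `𝐈 ≤ 4I` that is SINGULAR AT THE ORIGIN. (If shell
uniformity fails for every `θ = 1/(n+1)`, the bad shell points give images blowing up at their own
origin column at times `↑ 0`, and `stub_spherePersistence` applies.) -/
theorem orbitDichotomy {C : ℝ} {I : ℝ≥0∞} {u : ℝ → E³ → E³} {p : ℝ → E³ → ℝ}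
    {G : ℝ → E³ → E³ →L[ℝ] E³} (hI : I < ⊤)
    (hsw : IsSuitableWeakSolutionOn (slab E³ (Iio 0) isOpen_Iio) 1 0 u p)
    (hwg : HasWeakSpatialGradientOn (slab E³ (Iio 0) isOpen_Iio) u G)
    (hIle : typeIBound (Iio (0 : ℝ) ×ˢ univ) u p G ≤ I)
    (hC : HasTypeITimeDecay C u)
    (hcont : ContinuousOn (uncurry u) (Iio (0 : ℝ) ×ˢ univ)) :
    (∃ C' : ℝ, HasTypeIDecay C' u) ∨
    ∃ (lk : ℕ → ℝ) (xk : ℕ → E³) (v : ℝ → E³ → E³) (q : ℝ → E³ → ℝ) (H : ℝ → E³ → E³ →L[ℝ] E³),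
      (∀ k, 0 < lk k ∧ lk k ≤ ‖xk k‖ ∧ ‖xk k‖ ≤ 2 * lk k) ∧
      IsSuitableWeakSolutionOn (slab E³ (Iio 0) isOpen_Iio) 1 0 v q ∧
      HasWeakSpatialGradientOn (slab E³ (Iio 0) isOpen_Iio) v H ∧
      typeIBound (Iio (0 : ℝ) ×ˢ univ) v q H ≤ 4 * I ∧
      HasTypeITimeDecay C v ∧
      ContinuousOn (uncurry v) (Iio (0 : ℝ) ×ˢ univ) ∧
      (∀ R : ℝ, 0 < R → Tendsto (fun k => eLpNorm
        (uncurry (lk k • stPull (lk k ^ 2) (lk k) 0 (xk k) u) - uncurry v) 3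
        (volume.restrict (parabolicCylinder R (0 : ℝ × E³)))) atTop (𝓝 0)) ∧
      IsBackwardSingularPoint v 0 := by
  by_cases hshell : ∃ θ : ℝ, 0 < θ ∧ ∀ lam : ℝ, 0 < lam → ∀ t : ℝ, -θ ^ 2 < t → t < 0 →
      ∀ y : E³, 1 ≤ ‖y‖ → ‖y‖ ≤ 2 → lam * ‖u (lam ^ 2 * t) (lam • y)‖ ≤ θ⁻¹
  · obtain ⟨θ, hθ, h⟩ := hshell
    exact Or.inl ⟨_, shellUniformityGivesApex' hθ hC h⟩
  · right
    push Not at hshell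
    -- bad shell points at resolution `θ = 1/(n+1)`
    have hbad : ∀ n : ℕ, ∃ lam : ℝ, 0 < lam ∧ ∃ t : ℝ, -(1 / ((n : ℝ) + 1)) ^ 2 < t ∧ t < 0 ∧
        ∃ y : E³, 1 ≤ ‖y‖ ∧ ‖y‖ ≤ 2 ∧ (1 / ((n : ℝ) + 1))⁻¹ < lam * ‖u (lam ^ 2 * t) (lam • y)‖ := by
      intro n
      obtain ⟨lam, hlam, t, ht1, ht2, y, hy1, hy2, hlt⟩ := hshell (1 / ((n : ℝ) + 1)) (by positivity)
      exact ⟨lam, hlam, t, ht1, ht2, y, hy1, hy2, hlt⟩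
    choose lam hlam t ht1 ht2 y hy1 hy2 hlt using hbad
    -- the images centred at `x_k = λ_k y_k`
    have htk0 : Tendsto t atTop (𝓝 0) := by
      have hlow : Tendsto (fun n : ℕ => -(1 / ((n : ℝ) + 1)) ^ 2) atTop (𝓝 0) := by
        have h1 : Tendsto (fun n : ℕ => (1 / ((n : ℝ) + 1))) atTop (𝓝 0) :=
          tendsto_one_div_add_atTop_nhds_zero_nat
        have : Tendsto (fun n : ℕ => -((1 / ((n : ℝ) + 1)) ^ 2)) atTop (𝓝 (-(0 ^ 2))) :=
          (h1.pow 2).neg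
        simpa [neg_pow_two] using this
      refine tendsto_of_tendsto_of_tendsto_of_le_of_le hlow tendsto_const_nhds
        (fun n => (ht1 n).le) (fun n => (ht2 n).le)
    have hblow : Tendsto (fun k => lam k * ‖u (lam k ^ 2 * t k) (lam k • y k)‖) atTop atTop := by
      refine tendsto_atTop_mono (fun n => (hlt n).le) ?_
      have : Tendsto (fun n : ℕ => ((n : ℝ) + 1)) atTop atTop :=
        tendsto_atTop_add_const_right _ 1 tendsto_natCast_atTop_atTop
      refine this.congr fun n => ?_
      rw [one_div, inv_inv]
    obtain ⟨σ, v, q, H, hσ, hv, hvg, hvI, hvC, hvcont, hvsing, hconv⟩ :=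
      stub_spherePersistence C I u p G lam (fun k => lam k • y k) t hI hsw hwg hIle hC hcont
        hlam ht2 htk0 hblow
    refine ⟨lam ∘ σ, fun k => lam (σ k) • y (σ k), v, q, H, fun k => ⟨hlam _, ?_, ?_⟩, hv, hvg, hvI,
      hvC, hvcont, fun R hR => hconv R hR, hvsing⟩
    · show lam (σ k) ≤ ‖lam (σ k) • y (σ k)‖
      rw [norm_smul, Real.norm_of_nonneg (hlam _).le]
      nlinarith [hy1 (σ k), hlam (σ k)]
    · show ‖lam (σ k) • y (σ k)‖ ≤ 2 * lam (σ k)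
      rw [norm_smul, Real.norm_of_nonneg (hlam _).le]
      nlinarith [hy2 (σ k), hlam (σ k)]

/-! ### Composition -/

/-- COMPOSITION of the reshaped line `decaying-ancient-bridge` (v3): the five stubs imply the crux
`RellichScar.ApexLocalisation` (by name). The onion (stub 4, fed by stubs 2–3) is handed to the bet
(stub 5), which selects a continuous singular class profile with no origin-singular shell-centred
image limit; by the dichotomy (stub 1 + shell uniformity) that profile is apex. -/
theorem ApexLocalisation_of :
    Summit.NavierStokesRegularity.NavierStokesRegularity.Theses.RellichScar.ApexLocalisation := by
  intro C hant
  have honion := stub_onionShells stub_finalSliceNull stub_movingCentrePersistence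
  obtain ⟨C', I', u, p, G, hI', hsw, hwg, hIle, hC', hcont, hsing, hsparse⟩ :=
    stub_sparseSelection honion C hant
  rcases orbitDichotomy hI' hsw hwg hIle hC' hcont with ⟨C'', hdec⟩ |
    ⟨lk, xk, v, q, H, hadm, hv, hvg, hvI, hvC, hvcont, hconv, hvsing⟩
  · exact ⟨C'', u, p, G, hsw, hwg, lt_of_le_of_lt hIle hI', hdec, hsing⟩
  · exact absurd hvsing (hsparse lk xk v q H hadm hv hvg hvI hvC hvcont hconv)

end Summit.NavierStokesRegularity.NavierStokesRegularity.Theorems.RellichScarApexLocalisation
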